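import Summits.Ventures.PercRepro.GenQSevenFiveCorners

/-!
# PercRepro — the COLOOP BRIDGE: a flat with a coloop is «hyperplane + one point» (night-4, gen 2; RULING (rm)(4)(ii))

night-2's per-flat theorems R4 / R5 assume `mTr M G = 0` — the rank-`q` flat `G` has no coloop.  The complementary case is
free: a coloop `a` of `G` (`a ∉ cl(G ∖ a)`) makes `G = (G ∖ a) ∪ {a}` with `G ∖ a` of rank `q − 1` and `a ∉ cl(G ∖ a)`, so
the landed identity `Jq_hyp_add_one_eq` (`GenQHypAddOneAll.lean`) turns every balance of `G` into the signed sum on the trace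
`G ∖ a` — the «corner (i)» shape at every level and type.  This file states it:

* `exists_coloop_of_mTr_ne_zero`, `eRk_erase_of_coloop`: the coloop and the rank of the trace;
* `Jq_eq_trace_sum_of_coloop`: `Jq M G (q + 1) t = Σ_{B ∈ R_q(G ∖ a)} ((q + 3 − t)/(2 + m(B)) − Φ_{q+1}·dem (G ∖ a) t B)`;
* `Jq_nonneg_of_coloop_of_trace`: the balance of `G` is nonnegative as soon as that trace sum is;
* `TraceSumNonneg q t`: the trace sums at `(q + 1, t)` on rank-`q` sets of simple matroids, as a `Prop`, and
  `Jq_nonneg_of_mTr_ne_zero`: `TraceSumNonneg q t → mTr M G ≠ 0 → 0 ≤ Jq M G (q + 1) t`.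

So the per-flat statements may assume `mTr M G = 0` whenever the trace sums of the level below are known — at `(7, 5)` the
trace sums at `t = 2, 3, 4` on the rank-`4` traces are the corner-(i) census; `SevenFiveCornerOne ↔ TraceSumNonneg 4 4`
(`sevenFiveCornerOne_iff_traceSumNonneg`).  Imports `GenQSevenFiveCorners` (for `SevenFiveCornerOne`).
-/

namespace PercRepro.GenQ

open Finset ThmH SixFour

variable {α : Type*} [DecidableEq α] {M : Matroid α} [M.Finite]

/-- A set with `mTr M G ≠ 0` has a coloop: `a ∈ G` with `a ∉ cl(G ∖ a)`. -/
theorem exists_coloop_of_mTr_ne_zero {G : Finset α} (h : mTr M G ≠ 0) :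
    ∃ a ∈ G, a ∉ M.closure ((G.erase a : Finset α) : Set α) := by
  unfold mTr at h
  obtain ⟨a, ha⟩ := Finset.card_pos.1 (Nat.pos_of_ne_zero h)
  exact ⟨a, (mem_coloopsOf.1 ha).1, (mem_coloopsOf.1 ha).2⟩

/-- The trace `G ∖ a` of a rank-`(q + 1)` set at a coloop `a` has rank `q`. -/
theorem eRk_erase_of_coloop {G : Finset α} {a : α} {q : ℕ} (hG : G ⊆ gr M) (ha : a ∈ G)
    (hr : M.eRk (G : Set α) = ((q + 1 : ℕ) : ℕ∞)) (hacl : a ∉ M.closure ((G.erase a : Finset α) : Set α)) :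
    M.eRk ((G.erase a : Finset α) : Set α) = (q : ℕ∞) := by
  have haE : a ∈ M.E := by
    rw [← coe_gr M]
    exact_mod_cast hG ha
  have h1 : M.eRk (insert a ((G.erase a : Finset α) : Set α)) = M.eRk ((G.erase a : Finset α) : Set α) + 1 :=
    Matroid.eRk_insert_eq_add_one ⟨haE, hacl⟩
  have h2 : insert a ((G.erase a : Finset α) : Set α) = (G : Set α) := by
    rw [← Finset.coe_insert, Finset.insert_erase ha]
  rw [h2, hr] at h1
  have hfin : M.eRk ((G.erase a : Finset α) : Set α) ≠ ⊤ := by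
    intro htop
    rw [htop, top_add] at h1
    exact ENat.coe_ne_top _ h1
  obtain ⟨r, hr'⟩ := ENat.ne_top_iff_exists.1 hfin
  rw [← hr'] at h1 ⊢
  have : ((q + 1 : ℕ) : ℕ∞) = ((r + 1 : ℕ) : ℕ∞) := by
    rw [h1]
    push_cast
    rfl
  have hq : q + 1 = r + 1 := by exact_mod_cast this
  rw [show r = q by omega]

/-- **A flat with a coloop is «hyperplane + one point»**: the balance of `G` at `(q + 1, t)` is the signed trace sum on
`G ∖ a`. -/
theorem Jq_eq_trace_sum_of_coloop {G : Finset α} {a : α} {q : ℕ} (hG : G ⊆ gr M) (ha : a ∈ G)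
    (hr : M.eRk (G : Set α) = ((q + 1 : ℕ) : ℕ∞)) (hacl : a ∉ M.closure ((G.erase a : Finset α) : Set α)) (t : ℕ) :
    Jq M G (q + 1) t = ∑ B ∈ Rq M (G.erase a) q, ((((q + 1 : ℕ) : ℚ) + 2 - t) * (1 / (2 + (mTr M B : ℚ))) -
      ((((q + 1 : ℕ) : ℚ) + 2) / (((q + 1 : ℕ) : ℚ) + 1)) * dem M (G.erase a) t B) := by
  have haG : a ∈ gr M := hG ha
  have key := Jq_hyp_add_one_eq (M := M) (τ := G.erase a) haG (Finset.notMem_erase a G) hacl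
    (eRk_erase_of_coloop hG ha hr hacl) t
  rw [Finset.insert_erase ha] at key
  exact key

/-- The balance of a set with a coloop is nonnegative as soon as its trace sum is. -/
theorem Jq_nonneg_of_coloop_of_trace {G : Finset α} {a : α} {q : ℕ} (hG : G ⊆ gr M) (ha : a ∈ G)
    (hr : M.eRk (G : Set α) = ((q + 1 : ℕ) : ℕ∞)) (hacl : a ∉ M.closure ((G.erase a : Finset α) : Set α)) (t : ℕ)
    (htr : 0 ≤ ∑ B ∈ Rq M (G.erase a) q, ((((q + 1 : ℕ) : ℚ) + 2 - t) * (1 / (2 + (mTr M B : ℚ))) -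
      ((((q + 1 : ℕ) : ℚ) + 2) / (((q + 1 : ℕ) : ℚ) + 1)) * dem M (G.erase a) t B)) :
    0 ≤ Jq M G (q + 1) t := by
  rw [Jq_eq_trace_sum_of_coloop hG ha hr hacl t]
  exact htr

/-- **The trace sums of level `q + 1` at type `t`**, on every rank-`q` subset of a simple matroid (the «corner (i)» of
the level): `SevenFiveCornerOne` is `TraceSumNonneg 4 4` up to the spelling of the constants. -/
def TraceSumNonneg (q t : ℕ) : Prop :=
  ∀ {β : Type} [DecidableEq β] (M : Matroid β) [M.Finite] (H : Finset β), Simple M → H ⊆ gr M →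
    M.eRk (H : Set β) = (q : ℕ∞) →
    0 ≤ ∑ B ∈ Rq M H q, ((((q + 1 : ℕ) : ℚ) + 2 - t) * (1 / (2 + (mTr M B : ℚ))) -
      ((((q + 1 : ℕ) : ℚ) + 2) / (((q + 1 : ℕ) : ℚ) + 1)) * dem M H t B)

/-- **The coloop bridge**: with the trace sums of the level below, every rank-`(q + 1)` set with a coloop has a
nonnegative balance — so the per-flat statements of level `q + 1` may assume `mTr M G = 0`. -/
theorem Jq_nonneg_of_mTr_ne_zero {γ : Type} [DecidableEq γ] {M : Matroid γ} [M.Finite] {q t : ℕ}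
    (htr : TraceSumNonneg q t) (hs : Simple M) {G : Finset γ} (hG : G ⊆ gr M)
    (hr : M.eRk (G : Set γ) = ((q + 1 : ℕ) : ℕ∞)) (hm : mTr M G ≠ 0) : 0 ≤ Jq M G (q + 1) t := by
  obtain ⟨a, ha, hacl⟩ := exists_coloop_of_mTr_ne_zero hm
  exact Jq_nonneg_of_coloop_of_trace hG ha hr hacl t
    (htr M (G.erase a) hs ((Finset.erase_subset a G).trans hG) (eRk_erase_of_coloop hG ha hr hacl))

/-- The two spellings of the `(7, 5)` corner (i) agree term by term. -/
theorem cornerOne_term_eq (H : Finset α) (B : Finset α) :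
    ((((4 + 1 : ℕ) : ℚ) + 2 - (4 : ℕ)) * (1 / (2 + (mTr M B : ℚ))) -
      ((((4 + 1 : ℕ) : ℚ) + 2) / (((4 + 1 : ℕ) : ℚ) + 1)) * dem M H 4 B) =
    (3 / (2 + (mTr M B : ℚ)) - (7 / 6) * dem M H 4 B) := by
  push_cast
  ring

/-- **`SevenFiveCornerOne` is the trace-sum statement `TraceSumNonneg 4 4`.** -/
theorem sevenFiveCornerOne_iff_traceSumNonneg : SevenFiveCornerOne ↔ TraceSumNonneg 4 4 := by
  constructor
  · intro h β _ M _ H hs hH hr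
    have := h M H hs hH (by rw [hr]; rfl)
    refine le_trans this (le_of_eq ?_)
    exact Finset.sum_congr rfl (fun B _ => (cornerOne_term_eq H B).symm)
  · intro h β _ M _ H hs hH hr
    have := h M H hs hH (by rw [hr]; rfl)
    refine le_trans this (le_of_eq ?_)
    exact Finset.sum_congr rfl (fun B _ => cornerOne_term_eq H B)

/-- **At `(7, 5)`, `t = 4`: a rank-`5` set with a coloop has a nonnegative balance under corner (i).** -/
theorem Jq_five_four_nonneg_of_mTr_ne_zero {γ : Type} [DecidableEq γ] {M : Matroid γ} [M.Finite]
    (h1 : SevenFiveCornerOne) (hs : Simple M) {G : Finset γ} (hG : G ⊆ gr M) (hr : M.eRk (G : Set γ) = 5)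
    (hm : mTr M G ≠ 0) : 0 ≤ Jq M G 5 4 :=
  Jq_nonneg_of_mTr_ne_zero (q := 4) (t := 4) (sevenFiveCornerOne_iff_traceSumNonneg.1 h1) hs hG (by rw [hr]; rfl) hm

end PercRepro.GenQ
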